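import Literature.NumberTheory.LFunctions.WeilMellinBounds
import Literature.Analysis.Complex.VitaliConvergence
import Mathlib.Analysis.Distribution.AEEqOfIntegralContDiff
import Mathlib.LinearAlgebra.Dual.Lemmas
import HarnessLib

/-!
# PF-persistence, M2 seat (gen 5), part 1/3: interpolation by even real test functions on `[-1, 1]`

pub-rhpf cell, M2 seat, generation 5.  HONEST FRAMING: long-odds MECHANISM SEARCH around Weil's quadratic
functional; no RH claims anywhere in this cell.  Labels: PROVED (kernel) / CITED / HYPOTHESIS (explicit binder).

PROVED here (pure analysis, no zeta): for every finite set `Z` of points in the open quadrant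
`Re ρ > 1/2, Im ρ > 0` and any prescribed complex values `v`, there is an even, real-valued Weil test function
`φ` supported in `[-1, 1]` with `φ̂(ρ) = v(ρ)` on `Z` (`exists_evenRealTest_weilMellin_eq`; `φ̂ = weilMellin φ`).
Ingredients: linear independence of exponentials with distinct exponents on an interval
(`eq_zero_of_sum_mul_cexp_eq_zero`), the real-dual description of `ℂ^Z` (`dual_apply_eq_re_sum`), the
fundamental lemma of the calculus of variations (Mathlib `IsOpen.ae_eq_zero_of_integral_contDiff_smul_eq_zero`)
and `Literature.Analysis.Complex.eq_zero_of_ae_of_continuousOn`.  Used by part 2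
(`PfPersistenceM2EvenSectorIndexLower`) to build negative-definite even families for the Weil form.
-/

noncomputable section

set_option linter.dupNamespace false

open Complex Filter Set MeasureTheory
open scoped Real Topology ComplexConjugate BigOperators ContDiff

namespace Summit.RiemannHypothesis.RiemannHypothesis.Theorems.PfPersistenceM2NegIndex

open Literature.NumberTheory.LFunctions
open Literature.Analysis.Complex (eq_zero_of_ae_of_continuousOn)

/-! ## A. Exponentials with distinct exponents are linearly independent on an interval -/

/-- If `Σ_{k ∈ s} a_k e^{μ_k t} = 0` for all `t` in a non-empty open interval and the exponents `μ_k`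
(`k ∈ s`) are distinct, then every `a_k` vanishes.  (Induction on `s`: divide by `e^{μ_{k₀} t}`,
differentiate — the derivative of a function vanishing on an open interval vanishes there — and apply the
induction hypothesis to the coefficients `a_k (μ_k - μ_{k₀})`.) [folklore] -/
theorem eq_zero_of_sum_mul_cexp_eq_zero {ι : Type*} [DecidableEq ι] {u v : ℝ} (huv : u < v)
    (s : Finset ι) (μ a : ι → ℂ) (hinj : Set.InjOn μ s)
    (h : ∀ t ∈ Ioo u v, ∑ k ∈ s, a k * cexp (μ k * t) = 0) : ∀ k ∈ s, a k = 0 := by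
  induction s using Finset.induction_on generalizing μ a with
  | empty => simp
  | insert k₀ s hk₀ ih =>
    have hinj' : Set.InjOn (fun k ↦ μ k - μ k₀) s := by
      intro x hx y hy hxy
      have hxy' : μ x - μ k₀ = μ y - μ k₀ := hxy
      exact hinj (Finset.mem_insert_of_mem hx) (Finset.mem_insert_of_mem hy) (sub_left_inj.1 hxy')
    -- the shifted sum vanishes on the interval
    have hF : ∀ t ∈ Ioo u v, ∑ k ∈ insert k₀ s, a k * cexp ((μ k - μ k₀) * t) = 0 := by
      intro t ht
      have e1 : ∑ k ∈ insert k₀ s, a k * cexp ((μ k - μ k₀) * t) =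
          (∑ k ∈ insert k₀ s, a k * cexp (μ k * t)) / cexp (μ k₀ * t) := by
        rw [Finset.sum_div]
        refine Finset.sum_congr rfl fun k _ ↦ ?_
        rw [sub_mul, Complex.exp_sub, mul_div_assoc]
      rw [e1, h t ht, zero_div]
    -- so does its derivative
    have hD : ∀ t ∈ Ioo u v, ∑ k ∈ s, a k * (μ k - μ k₀) * cexp ((μ k - μ k₀) * t) = 0 := by
      intro t ht
      have h1 := HasDerivAt.fun_sum (u := insert k₀ s)
        (A := fun k (x : ℝ) ↦ a k * cexp ((μ k - μ k₀) * x))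
        (fun k _ ↦ ((((hasDerivAt_id' t).ofReal_comp).const_mul (μ k - μ k₀)).cexp).const_mul (a k))
      have h2 : HasDerivAt (fun x : ℝ ↦ ∑ k ∈ insert k₀ s, a k * cexp ((μ k - μ k₀) * x)) 0 t := by
        refine (hasDerivAt_const t (0 : ℂ)).congr_of_eventuallyEq ?_
        filter_upwards [isOpen_Ioo.mem_nhds ht] with x hx
        exact hF x hx
      have h3 := h1.unique h2
      rw [Finset.sum_insert hk₀] at h3
      simp only [sub_self, zero_mul, mul_zero, zero_add, Complex.ofReal_one, mul_one] at h3
      rw [← h3]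
      refine Finset.sum_congr rfl fun k _ ↦ ?_
      ring
    have hzero := ih (fun k ↦ μ k - μ k₀) (fun k ↦ a k * (μ k - μ k₀)) hinj' hD
    -- coefficients on `s` vanish
    have hs : ∀ k ∈ s, a k = 0 := by
      intro k hk
      have hne : μ k - μ k₀ ≠ 0 := by
        intro h0
        have hkk : k = k₀ :=
          hinj (Finset.mem_insert_of_mem hk) (Finset.mem_insert_self _ _) (sub_eq_zero.1 h0)
        exact hk₀ (hkk ▸ hk)
      have h0 : a k * (μ k - μ k₀) = 0 := hzero k hk
      exact (mul_eq_zero.1 h0).resolve_right hne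
    -- and so does the remaining one
    have hk₀' : a k₀ = 0 := by
      obtain ⟨t, ht⟩ : (Ioo u v).Nonempty := nonempty_Ioo.2 huv
      have h0 := h t ht
      rw [Finset.sum_insert hk₀, Finset.sum_eq_zero (fun k hk ↦ by rw [hs k hk, zero_mul]),
        add_zero] at h0
      exact (mul_eq_zero.1 h0).resolve_right (Complex.exp_ne_zero _)
    intro k hk
    rcases Finset.mem_insert.1 hk with rfl | hk
    · exact hk₀'
    · exact hs k hk

/-! ## B. Interpolation on a finite set of quadrant points by even real test functions on `[-1, 1]` -/

/-- A real-linear functional on `Z → ℂ` is `u ↦ Re Σ_ρ wc_ρ u_ρ` with `wc_ρ = f(e_ρ) - i f(i e_ρ)`. [folklore] -/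
theorem dual_apply_eq_re_sum (Z : Finset ℂ) (f : Module.Dual ℝ (Z → ℂ)) (u : Z → ℂ) :
    f u = (∑ ρ : Z, ((((f (Pi.single ρ 1)) : ℝ) : ℂ) - (((f (Pi.single ρ I)) : ℝ) : ℂ) * I) * u ρ).re := by
  classical
  have hu : u = ∑ ρ : Z, ((u ρ).re • (Pi.single ρ (1 : ℂ) : Z → ℂ) +
      (u ρ).im • (Pi.single ρ I : Z → ℂ)) := by
    conv_lhs => rw [← Finset.univ_sum_single u]
    refine Finset.sum_congr rfl fun ρ _ ↦ ?_
    rw [← Pi.single_smul, ← Pi.single_smul, ← Pi.single_add]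
    congr 1
    rw [Complex.real_smul, Complex.real_smul, mul_one, Complex.re_add_im]
  conv_lhs => rw [hu]
  rw [map_sum, Complex.re_sum]
  refine Finset.sum_congr rfl fun ρ _ ↦ ?_
  rw [map_add, map_smul, map_smul, smul_eq_mul, smul_eq_mul]
  simp only [Complex.mul_re, Complex.sub_re, Complex.sub_im, Complex.ofReal_re, Complex.ofReal_im,
    Complex.mul_im, Complex.I_re, Complex.I_im]
  ring

/-- Transform of the even extension `t ↦ ψ(t) + ψ(-t)` of a real continuous compactly supported `ψ`:
`∫ ψ(t) (e^{(s-1/2)t} + e^{-(s-1/2)t}) dt`. [folklore] -/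
theorem weilMellin_evenExtension {ψ : ℝ → ℝ} (hψ : Continuous ψ) (hc : HasCompactSupport ψ) (s : ℂ) :
    weilMellin (fun t : ℝ ↦ ((ψ t : ℝ) : ℂ) + ((ψ (-t) : ℝ) : ℂ)) s =
      ∫ t : ℝ, ((ψ t : ℝ) : ℂ) * (cexp ((s - 1 / 2) * t) + cexp (-((s - 1 / 2) * t))) := by
  have h1 : Integrable fun t : ℝ ↦ ((ψ t : ℝ) : ℂ) * cexp ((s - 1 / 2) * t) :=
    integrable_weilIntegrand (Complex.continuous_ofReal.comp hψ) (hc.comp_left Complex.ofReal_zero) s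
  have hψn : Continuous fun t : ℝ ↦ ψ (-t) := hψ.comp continuous_neg
  have hcn : HasCompactSupport fun t : ℝ ↦ ψ (-t) := hc.comp_homeomorph (Homeomorph.neg ℝ)
  have h2 : Integrable fun t : ℝ ↦ ((ψ (-t) : ℝ) : ℂ) * cexp ((s - 1 / 2) * t) :=
    integrable_weilIntegrand (Complex.continuous_ofReal.comp hψn) (hcn.comp_left Complex.ofReal_zero) s
  have h3 : Integrable fun t : ℝ ↦ ((ψ t : ℝ) : ℂ) * cexp (-((s - 1 / 2) * t)) := by
    have e : (fun t : ℝ ↦ ((ψ t : ℝ) : ℂ) * cexp ((1 - s - 1 / 2) * t)) =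
        fun t : ℝ ↦ ((ψ t : ℝ) : ℂ) * cexp (-((s - 1 / 2) * t)) := by
      funext t
      congr 2
      ring
    rw [← e]
    exact integrable_weilIntegrand (Complex.continuous_ofReal.comp hψ) (hc.comp_left Complex.ofReal_zero) _
  have hrefl : ∫ t : ℝ, ((ψ (-t) : ℝ) : ℂ) * cexp ((s - 1 / 2) * t) =
      ∫ t : ℝ, ((ψ t : ℝ) : ℂ) * cexp (-((s - 1 / 2) * t)) := by
    have h := integral_neg_eq_self
      (fun t : ℝ ↦ ((ψ t : ℝ) : ℂ) * cexp ((s - 1 / 2) * ((-t : ℝ) : ℂ))) volume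
    simp only [neg_neg] at h
    rw [h]
    congr 1 with t
    rw [Complex.ofReal_neg, mul_neg]
  show (∫ t : ℝ, (((ψ t : ℝ) : ℂ) + ((ψ (-t) : ℝ) : ℂ)) * cexp ((s - 1 / 2) * t)) = _
  simp_rw [add_mul]
  rw [integral_add h1 h2, hrefl, ← integral_add h1 h3]
  simp_rw [mul_add]

/-- **Interpolation.**  For a finite set `Z` of points in the open quadrant `Re ρ > 1/2`, `Im ρ > 0` and any
prescribed values `v`, there is an even, real-valued Weil test function `φ` supported in `[-1, 1]` with
`φ̂(ρ) = v(ρ)` for every `ρ ∈ Z`.  Proof: if the `ℝ`-linear evaluation map were not onto `ℂ^Z`, a non-zero real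
functional `u ↦ Re Σ wc_ρ u_ρ` would kill its range; testing against `φ = ψ(t) + ψ(-t)` with `ψ` smooth and
supported in `(0, 1)` gives `∫ ψ · Re K = 0`, `K(t) = Σ wc_ρ (e^{λ_ρ t} + e^{-λ_ρ t})`, `λ_ρ = ρ - 1/2`, so
`Re K = 0` on `(0, 1)` (smooth functions are dense), i.e. an exponential sum with the `4 #Z` DISTINCT exponents
`±λ_ρ, ±conj λ_ρ` vanishes on an interval — forcing `wc = 0` (`eq_zero_of_sum_mul_cexp_eq_zero`). [folklore] -/
theorem exists_evenRealTest_weilMellin_eq (Z : Finset ℂ) (hZ : ∀ ρ ∈ Z, 1 / 2 < ρ.re ∧ 0 < ρ.im)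
    (v : ℂ → ℂ) :
    ∃ φ : ℝ → ℂ, IsWeilTest φ ∧ (∀ t : ℝ, φ (-t) = φ t) ∧ (∀ t : ℝ, (φ t).im = 0) ∧
      tsupport φ ⊆ Icc (-1) 1 ∧ ∀ ρ ∈ Z, weilMellin φ ρ = v ρ := by
  classical
  -- the `ℝ`-submodule `V` of even, real-valued Weil test functions supported in `[-1, 1]`
  let V : Submodule ℝ (ℝ → ℂ) :=
    { carrier := {φ | IsWeilTest φ ∧ (∀ t : ℝ, φ (-t) = φ t) ∧ (∀ t : ℝ, (φ t).im = 0) ∧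
        tsupport φ ⊆ Icc (-1) 1}
      add_mem' := by
        rintro φ ψ ⟨hφ, heφ, hrφ, hsφ⟩ ⟨hψ, heψ, hrψ, hsψ⟩
        refine ⟨hφ.add hψ, fun t ↦ by simp only [Pi.add_apply, heφ, heψ], fun t ↦ by
          simp only [Pi.add_apply, Complex.add_im, hrφ, hrψ, add_zero], ?_⟩
        exact closure_minimal ((Function.support_add φ ψ).trans
          (union_subset ((subset_tsupport φ).trans hsφ) ((subset_tsupport ψ).trans hsψ))) isClosed_Icc
      zero_mem' := by
        refine ⟨⟨contDiff_const, HasCompactSupport.zero⟩, fun t ↦ rfl, fun t ↦ by simp, ?_⟩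
        exact closure_minimal (fun t ht ↦ absurd rfl ht) isClosed_Icc
      smul_mem' := by
        rintro c φ ⟨hφ, heφ, hrφ, hsφ⟩
        have hc : c • φ = fun t ↦ (c : ℂ) * φ t := by
          funext t
          simp only [Pi.smul_apply, Complex.real_smul]
        refine ⟨hc ▸ hφ.const_mul c, fun t ↦ by simp only [Pi.smul_apply, heφ], fun t ↦ by
          simp only [Pi.smul_apply, Complex.real_smul, Complex.im_ofReal_mul, hrφ, mul_zero], ?_⟩
        refine closure_minimal (fun t ht ↦ ?_) isClosed_Icc
        have hne : φ t ≠ 0 := by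
          intro h0
          apply ht
          simp only [Pi.smul_apply, h0, smul_zero]
        exact hsφ (subset_tsupport φ hne) }
  have hmemV : ∀ {φ : ℝ → ℂ}, φ ∈ V ↔ IsWeilTest φ ∧ (∀ t : ℝ, φ (-t) = φ t) ∧
      (∀ t : ℝ, (φ t).im = 0) ∧ tsupport φ ⊆ Icc (-1) 1 := Iff.rfl
  -- evaluation of the transform at the points of `Z`, an `ℝ`-linear map
  let L : V →ₗ[ℝ] (Z → ℂ) :=
    { toFun := fun φ ρ ↦ weilMellin (φ : ℝ → ℂ) ρ
      map_add' := fun φ ψ ↦ by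
        funext ρ
        have h1 := (hmemV.1 φ.2).1
        have h2 := (hmemV.1 ψ.2).1
        simp only [Submodule.coe_add, Pi.add_apply]
        exact weilMellin_add h1.1.continuous h1.2 h2.1.continuous h2.2 _
      map_smul' := fun c φ ↦ by
        funext ρ
        have e : ((c • φ : V) : ℝ → ℂ) = fun t ↦ (c : ℂ) * (φ : ℝ → ℂ) t := by
          funext t
          simp only [Submodule.coe_smul, Pi.smul_apply, Complex.real_smul]
        rw [e, weilMellin_const_mul]
        simp only [RingHom.id_apply, Pi.smul_apply, Complex.real_smul] }
  have hLapply : ∀ (φ : V) (ρ : Z), L φ ρ = weilMellin (φ : ℝ → ℂ) ρ := fun _ _ ↦ rfl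
  suffices hsurj : Function.Surjective L by
    obtain ⟨φ, hφ⟩ := hsurj fun ρ ↦ v ρ
    obtain ⟨h1, h2, h3, h4⟩ := hmemV.1 φ.2
    exact ⟨φ, h1, h2, h3, h4, fun ρ hρ ↦ by rw [← hLapply φ ⟨ρ, hρ⟩, hφ]⟩
  by_contra hns
  have hlt : LinearMap.range L < ⊤ :=
    lt_top_iff_ne_top.2 fun h ↦ hns (LinearMap.range_eq_top.1 h)
  obtain ⟨f, hf0, hfmap⟩ := Submodule.exists_dual_map_eq_bot_of_lt_top hlt inferInstance
  have hkill : ∀ φ : V, f (L φ) = 0 := fun φ ↦ by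
    have hmem : f (L φ) ∈ (LinearMap.range L).map f :=
      Submodule.mem_map_of_mem (LinearMap.mem_range_self _ φ)
    rw [hfmap] at hmem
    exact (Submodule.mem_bot ℝ).1 hmem
  -- the coefficients `wc_ρ = α_ρ - i β_ρ` of `f`, the exponents `λ_ρ = ρ - 1/2`, the kernel `K`
  set α : Z → ℝ := fun ρ ↦ f (Pi.single ρ 1) with hα
  set β : Z → ℝ := fun ρ ↦ f (Pi.single ρ I) with hβ
  set wc : Z → ℂ := fun ρ ↦ ((α ρ : ℝ) : ℂ) - ((β ρ : ℝ) : ℂ) * I with hwc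
  have hrep : ∀ u : Z → ℂ, f u = (∑ ρ : Z, wc ρ * u ρ).re := fun u ↦ dual_apply_eq_re_sum Z f u
  set lam : Z → ℂ := fun ρ ↦ (ρ : ℂ) - 1 / 2 with hlam
  set K : ℝ → ℂ := fun t ↦ ∑ ρ : Z, wc ρ * (cexp (lam ρ * t) + cexp (-(lam ρ * t))) with hK
  have hKcont : Continuous K := by
    simp only [hK]
    fun_prop
  -- Step 1: `Re K` integrates to zero against every smooth `ψ` supported in `(0, 1)`
  have hint : ∀ ψ : ℝ → ℝ, ContDiff ℝ ∞ ψ → HasCompactSupport ψ → tsupport ψ ⊆ Ioo 0 1 →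
      ∫ t : ℝ, ψ t * (K t).re = 0 := by
    intro ψ hψ hψc hψs
    -- the even real test function `φ_ψ(t) = ψ(t) + ψ(-t)`, supported in `(-1, 0) ∪ (0, 1)`
    set φψ : ℝ → ℂ := fun t ↦ ((ψ t : ℝ) : ℂ) + ((ψ (-t) : ℝ) : ℂ) with hφψ
    have hmemφ : φψ ∈ V := by
      refine ⟨⟨?_, ?_⟩, fun t ↦ ?_, fun t ↦ ?_, ?_⟩
      · exact (Complex.ofRealCLM.contDiff.comp hψ).add
          (Complex.ofRealCLM.contDiff.comp (hψ.comp contDiff_neg))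
      · exact (hψc.comp_left Complex.ofReal_zero).add
          ((hψc.comp_homeomorph (Homeomorph.neg ℝ)).comp_left Complex.ofReal_zero)
      · simp only [hφψ, neg_neg]
        ring
      · simp only [hφψ, Complex.add_im, Complex.ofReal_im, add_zero]
      · refine closure_minimal (fun t ht ↦ ?_) isClosed_Icc
        rw [Function.mem_support] at ht
        by_contra hout
        apply ht
        have hψ0 : ∀ x : ℝ, x ∉ Icc (-1 : ℝ) 1 → ψ x = 0 := fun x hx ↦
          image_eq_zero_of_notMem_tsupport fun hx' ↦ hx (by
            have h' := hψs hx'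
            rw [mem_Ioo] at h'
            rw [mem_Icc]
            constructor <;> linarith [h'.1, h'.2])
        have h1 : ψ t = 0 := hψ0 t hout
        have h2 : ψ (-t) = 0 := hψ0 (-t) fun hmem ↦ hout (by
          rw [mem_Icc] at hmem ⊢
          constructor <;> linarith [hmem.1, hmem.2])
        simp only [hφψ, h1, h2, Complex.ofReal_zero, add_zero]
    -- `f` kills its transform values
    have h0 : (∑ ρ : Z, wc ρ * weilMellin φψ ρ).re = 0 := by
      rw [← hrep]
      exact hkill ⟨φψ, hmemφ⟩
    -- `Σ wc_ρ φ̂_ψ(ρ) = ∫ ψ K`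
    have hbase : ∀ ρ : Z, Integrable fun t : ℝ ↦
        ((ψ t : ℝ) : ℂ) * (cexp (lam ρ * t) + cexp (-(lam ρ * t))) := fun ρ ↦
      ((Complex.continuous_ofReal.comp hψ.continuous).mul (by fun_prop)).integrable_of_hasCompactSupport
        (hψc.comp_left Complex.ofReal_zero).mul_right
    have hsum : ∑ ρ : Z, wc ρ * weilMellin φψ ρ = ∫ t : ℝ, ((ψ t : ℝ) : ℂ) * K t := by
      calc ∑ ρ : Z, wc ρ * weilMellin φψ ρ
          = ∑ ρ : Z, ∫ t : ℝ, wc ρ * (((ψ t : ℝ) : ℂ) * (cexp (lam ρ * t) + cexp (-(lam ρ * t)))) := by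
            refine Finset.sum_congr rfl fun ρ _ ↦ ?_
            rw [hφψ, weilMellin_evenExtension hψ.continuous hψc, ← integral_const_mul]
        _ = ∫ t : ℝ, ∑ ρ : Z, wc ρ * (((ψ t : ℝ) : ℂ) * (cexp (lam ρ * t) + cexp (-(lam ρ * t)))) :=
            (integral_finsetSum Finset.univ fun ρ _ ↦ (hbase ρ).const_mul (wc ρ)).symm
        _ = ∫ t : ℝ, ((ψ t : ℝ) : ℂ) * K t := by
            congr 1 with t
            simp only [hK, Finset.mul_sum]
            refine Finset.sum_congr rfl fun ρ _ ↦ ?_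
            ring
    have hintK : Integrable fun t : ℝ ↦ ((ψ t : ℝ) : ℂ) * K t :=
      ((Complex.continuous_ofReal.comp hψ.continuous).mul hKcont).integrable_of_hasCompactSupport
        (hψc.comp_left Complex.ofReal_zero).mul_right
    have hI := integral_re hintK
    simp only [RCLike.re_to_complex, Complex.re_ofReal_mul] at hI
    rw [hI, ← hsum]
    exact h0
  -- Step 2: `Re K = 0` on `(0, 1)`
  have hloc : LocallyIntegrableOn (fun t : ℝ ↦ (K t).re) (Ioo 0 1) volume :=
    (Complex.continuous_re.comp hKcont).locallyIntegrable.locallyIntegrableOn _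
  have hae : ∀ᵐ t : ℝ, t ∈ Ioo (0 : ℝ) 1 → (K t).re = 0 :=
    isOpen_Ioo.ae_eq_zero_of_integral_contDiff_smul_eq_zero hloc fun ψ hψ hψc hψs ↦ by
      simpa only [smul_eq_mul] using hint ψ hψ hψc hψs
  have hzero : ∀ t ∈ Ioo (0 : ℝ) 1, (K t).re = 0 := by
    intro t ht
    have h := eq_zero_of_ae_of_continuousOn (h := fun t ↦ (((K t).re : ℝ) : ℂ)) (a := 0) (b := 1)
      ((Complex.continuous_ofReal.comp (Complex.continuous_re.comp hKcont)).continuousOn)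
      (hae.mono fun x hx hxI ↦ by rw [hx hxI, Complex.ofReal_zero]) ht
    exact_mod_cast h
  -- Step 3: `K + conj K = 0` on `(0, 1)` is an exponential sum with `4 #Z` distinct exponents
  let μ4 : Z × (Bool × Bool) → ℂ := fun p ↦
    (if p.2.1 then 1 else -1) * (if p.2.2 then lam p.1 else conj (lam p.1))
  let a4 : Z × (Bool × Bool) → ℂ := fun p ↦ if p.2.2 then wc p.1 else conj (wc p.1)
  have hδ : ∀ ρ : Z, 0 < (lam ρ).re := fun ρ ↦ by
    have := (hZ ρ ρ.2).1
    simp only [hlam, Complex.sub_re, Complex.div_ofNat_re, Complex.one_re]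
    linarith
  have hγ : ∀ ρ : Z, 0 < (lam ρ).im := fun ρ ↦ by
    have := (hZ ρ ρ.2).2
    simp only [hlam, Complex.sub_im, Complex.div_ofNat_im, Complex.one_im]
    linarith
  have hinj : Set.InjOn μ4 (Finset.univ : Finset (Z × (Bool × Bool))) := by
    rintro ⟨ρ, b, c⟩ - ⟨ρ', b', c'⟩ - h
    have hr := congrArg Complex.re h
    have hi := congrArg Complex.im h
    have hρr := hδ ρ
    have hρi := hγ ρ
    have hρ'r := hδ ρ'
    have hρ'i := hγ ρ'
    have key : lam ρ = lam ρ' → ρ = ρ' := fun hl ↦ by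
      apply Subtype.ext
      have := congrArg (fun z ↦ z + 1 / 2) hl
      simpa [hlam] using this
    cases b <;> cases c <;> cases b' <;> cases c' <;>
      simp only [μ4, if_true, if_false, Bool.false_eq_true, one_mul, neg_mul, neg_neg,
        Complex.neg_re, Complex.neg_im, Complex.conj_re, Complex.conj_im, one_mul] at hr hi <;>
      first
        | (exfalso; linarith)
        | (simp only [Prod.mk.injEq, and_true]
           exact key (Complex.ext (by linarith) (by linarith)))
  have hvan4 : ∀ t ∈ Ioo (0 : ℝ) 1, ∑ p ∈ (Finset.univ : Finset (Z × (Bool × Bool))),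
      a4 p * cexp (μ4 p * t) = 0 := by
    intro t ht
    have hKt : K t + conj (K t) = 0 := by
      rw [Complex.add_conj, hzero t ht]
      simp
    have hexp : ∀ z : ℂ, conj (cexp (z * t)) = cexp (conj z * t) := fun z ↦ by
      rw [← Complex.exp_conj, map_mul, Complex.conj_ofReal]
    have hexpn : ∀ z : ℂ, conj (cexp (-(z * t))) = cexp (-(conj z * t)) := fun z ↦ by
      rw [← Complex.exp_conj, map_neg, map_mul, Complex.conj_ofReal]
    rw [← hKt]
    simp only [hK, map_sum, map_mul, map_add, hexp, hexpn, ← Finset.sum_add_distrib]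
    rw [Fintype.sum_prod_type]
    refine Finset.sum_congr rfl fun ρ _ ↦ ?_
    rw [Fintype.sum_prod_type]
    simp only [Fintype.sum_bool, a4, μ4, Bool.false_eq_true, ↓reduceIte, one_mul, neg_mul]
    ring
  have hcoef := eq_zero_of_sum_mul_cexp_eq_zero zero_lt_one Finset.univ μ4 a4 hinj hvan4
  -- Step 4: hence `wc = 0` and `f = 0`
  have hwc0 : ∀ ρ : Z, wc ρ = 0 := fun ρ ↦ by
    have := hcoef (ρ, (true, true)) (Finset.mem_univ _)
    simpa [a4] using this
  refine hf0 (LinearMap.ext fun u ↦ ?_)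
  rw [hrep u, LinearMap.zero_apply]
  simp [hwc0]

end Summit.RiemannHypothesis.RiemannHypothesis.Theorems.PfPersistenceM2NegIndex

end
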